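import Summits.QuantumFields.YangMills.Theorems.LuscherReductionTwistedTraceScalingTowerOfUniform
import HarnessLib

/-!
# TOWER-E1 ∧ S-BASE ⇒ the UNIFORM femto trace law ⇒ the all-pairs S-TOWER: skeleton rev 2 «E1 COVERAGE» and rev 1 of line «twolattice»
# carry the SAME content modulo S-BASE (kernel-checked bookkeeping; crux `TwistedTraceScaling`, stmt-QuantumFields-20203)

Route `LuscherReduction` (owner ym-beyond-p1), crux `TwistedTraceScaling` (stmt-QuantumFields-20203), line «twolattice», skeleton rev 2
(sha16 34fd93842c24ce0a; registered stubs `stub_towerE1` = TOWER-E1 and `stub_fixedLatticeTraceLaw` = S-BASE).  The tree already has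
(lead g0, `…TowerOfUniform`, `…TowerE1`):

  `UFTL ⇒ S-TOWER(all pairs) ⇒ TOWER-E1`,   `S-TOWER ∧ S-BASE ⇒ UFTL`,   `TOWER-E1 ∧ S-BASE ⇒ TwistedTraceScaling`,

where `UFTL` is the `L`-UNIFORM femto trace law (`∃ L0` BEFORE `∀ lam`: `|traceRatio L β (femtoSteps s β L) − hTraceRatio s| ≤ ε` for all
`L ≥ L0`, all depths `lam ≤ lam0`, all `β` in the window).  This file closes the loop:

* §1 ★ `uniform_of_towerE1_of_base : TOWER-E1 → ⟨S-BASE body⟩ → UFTL` — with threshold `L0 = M²`.  Proof: TOWER-E1 at `ε/2` gives `M` and a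
  depth; S-BASE at `ε/2` on each base `b < M²` gives thresholds of which a FINITE max `β⋆` is taken; for `lam ≤ min(lamT, 1/2, 1/(4·max(β⋆,1)))`
  every `(L, β)` in the window with `L ≥ M²` lands (`Tower.exists_tower_landing`) on some base `b ∈ [M, M²)`, the matched coarse coupling
  `β₁ ≥ 1` exists (`Tower.exists_matched`, IVT) and is `≥ 1/(4lam³) ≥ β⋆` (`Tower.matched_ge`); triangle through `r(b, β₁, T_b)`.
  The point: the E1 base range `[M, M²)` is FINITE and `M` does not depend on `lam`, so at matched label every base pair is automatically
  in its own fixed-lattice semiclassical regime — coverage costs nothing modulo S-BASE.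
* §2 ★ `tower_of_towerE1_of_base : TOWER-E1 → ⟨S-BASE body⟩ → ⟨rev-1 S-TOWER body, all pairs L ≥ L₁ ≥ L0⟩` (§1 + `twoLatticeUniversality_of_uniform`).

So, modulo the fixed-lattice law S-BASE (sized «L», lanes luscher-20007-p1 / coarse-s1), the three texts TOWER-E1 (registered rev 2), S-TOWER
(rev 1) and UFTL are INTERCHANGEABLE; the E1 reshaping of the registry (owner ruling GENERAL-L-COVERAGE R2/R3) neither weakened nor strengthened
the open content, which is and remains the `L`-uniformity of Lüscher's femto trace law (constructive step-scaling universality of the low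
zero-flux transfer spectrum; located open estimates (E1′)–(E3′) of the lead census, none in print).
HONEST FRAMING: a reduction between hypothesis texts; TOWER-E1 / UFTL are OPEN; femto rung R2b1 of a CONDITIONAL reduction route; nothing here is
infinite volume, a mass gap, or Clay.  No definitions, no new named facts.  Imports: the cone-free `…TowerOfUniform` only (the E1 landing
arithmetic of `…TowerE1` §1 is re-proved privately so that this module stays out of the route file's import cone).
-/

set_option autoImplicit false

noncomputable section

open MeasureTheory Filter Topology Real
open scoped BigOperators

namespace Summit.QuantumFields.YangMills.Theorems.FemtoTransferGap.TwoLattice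

open Summit.QuantumFields.YangMills.Theorems.FemtoTransferGap
open Summit.QuantumFields.YangMills.Theorems.FemtoTransferGap.TraceDoor

namespace Tower

/-! ## §0 E1 landing arithmetic (private copy of `Tower.exists_tower_landing`, `…TowerE1` §1, owner g24 — kept private to avoid the Theses cone) -/

/-- E1 landing: for `M ≥ 2` and `L ≥ M²` there are `k` and a base `b ∈ [M, M²)` with `b·M^{k+1} ≤ L < b·M^k·(M+1)`. [folklore] -/
private theorem landing {M : ℕ} (hM : 2 ≤ M) {L : ℕ} (hL : M ^ 2 ≤ L) :
    ∃ k b : ℕ, M ≤ b ∧ b < M ^ 2 ∧ b * M ^ (k + 1) ≤ L ∧ L < b * M ^ k * (M + 1) := by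
  -- proof copied from `Tower.exists_tower_landing` (ported there from the owner's CoverageSketch.lean)
  have hM1 : 1 < M := hM
  have hL0 : L ≠ 0 := by
    have : 0 < M ^ 2 := by positivity
    omega
  have h1 : M ^ Nat.log M L ≤ L := Nat.pow_log_le_self M hL0
  have h2 : L < M ^ (Nat.log M L + 1) := Nat.lt_pow_succ_log_self hM1 L
  have he2 : 2 ≤ Nat.log M L := Nat.le_log_of_pow_le hM1 hL
  obtain ⟨k, hk⟩ : ∃ k, Nat.log M L = k + 2 := ⟨Nat.log M L - 2, by omega⟩
  rw [hk] at h1 h2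
  have hpow : 0 < M ^ (k + 1) := by positivity
  have hL1 : M ≤ L / M ^ (k + 1) := by
    apply (Nat.le_div_iff_mul_le hpow).mpr
    calc M * M ^ (k + 1) = M ^ (k + 2) := by ring
      _ ≤ L := h1
  refine ⟨k, L / M ^ (k + 1), hL1, ?_, Nat.div_mul_le_self L (M ^ (k + 1)), ?_⟩
  · apply (Nat.div_lt_iff_lt_mul hpow).mpr
    calc L < M ^ (k + 2 + 1) := h2
      _ = M ^ 2 * M ^ (k + 1) := by ring
  · have hstep : M ^ (k + 1) ≤ L / M ^ (k + 1) * M ^ k := by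
      calc M ^ (k + 1) = M * M ^ k := by ring
        _ ≤ L / M ^ (k + 1) * M ^ k := Nat.mul_le_mul_right _ hL1
    calc L < L / M ^ (k + 1) * M ^ (k + 1) + M ^ (k + 1) := Nat.lt_div_mul_add hpow
      _ ≤ L / M ^ (k + 1) * M ^ (k + 1) + L / M ^ (k + 1) * M ^ k := by omega
      _ = L / M ^ (k + 1) * M ^ k * (M + 1) := by ring

/-! ## §1 ★ TOWER-E1 and S-BASE give the uniform femto trace law -/

/-- ★ **`UFTL` from TOWER-E1 and S-BASE** (hypotheses = VERBATIM the bodies of the registered rev-2 stubs `Stmt.stub_towerE1` and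
`Stmt.stub_fixedLatticeTraceLaw`; conclusion = the `L`-uniform femto trace law with threshold `M²`).  TOWER-E1 at `ε/2` gives `M` and a depth
`lamT`; S-BASE at `ε/2` on every base `b < M²` gives thresholds, `β⋆` their finite max; for `lam ≤ min(lamT, 1/2, 1/(4·max(β⋆,1)))` every `(L, β)`
in the window with `L ≥ M²` lands on a base `b ∈ [M, M²)` (`Tower.exists_tower_landing`, private copy `landing`), a matched `β₁ ≥ 1` on `b` exists (`exists_matched`) and is
`≥ 1/(4lam³) ≥ β⋆` (`matched_ge`); triangle through `traceRatio b β₁ (femtoSteps s β₁ b)`. [cite: Luscher1983, §3] [cite: MontvayMunster1994, (3.145)] -/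
theorem uniform_of_towerE1_of_base
    (hE1 : ∀ s : ℝ, 0 < s → ∀ ε : ℝ, 0 < ε → ∃ M : ℕ, 2 ≤ M ∧ ∃ lam0 : ℝ, 0 < lam0 ∧ ∀ lam : ℝ, 0 < lam → lam ≤ lam0 →
      ∀ (L : ℕ) [NeZero L], M ^ 2 ≤ L → ∀ β : ℝ, InFemtoWindow lam β L →
        ∀ (b k : ℕ) [NeZero b], M ≤ b → b < M ^ 2 → b * M ^ (k + 1) ≤ L → L < b * M ^ k * (M + 1) →
          ∀ β₁ : ℝ, 1 ≤ β₁ → invRunningCoupling β₁ b = invRunningCoupling β L →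
            |traceRatio L β (femtoSteps s β L) - traceRatio b β₁ (femtoSteps s β₁ b)| ≤ ε)
    (hBASE : ∀ (L1 : ℕ) [NeZero L1] (s : ℝ), 0 < s → ∀ ε : ℝ, 0 < ε → ∃ β1 : ℝ, ∀ β : ℝ, β1 ≤ β →
      |traceRatio L1 β (femtoSteps s β L1) - hTraceRatio s| ≤ ε) :
    ∀ s : ℝ, 0 < s → ∀ ε : ℝ, 0 < ε → ∃ L0 : ℕ, ∃ lam0 : ℝ, 0 < lam0 ∧ ∀ lam : ℝ, 0 < lam → lam ≤ lam0 →
      ∀ (L : ℕ) [NeZero L], L0 ≤ L → ∀ β : ℝ, InFemtoWindow lam β L →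
        |traceRatio L β (femtoSteps s β L) - hTraceRatio s| ≤ ε := by
  intro s hs ε hε
  have hε2 : 0 < ε / 2 := by positivity
  obtain ⟨M, hM, lamT, hlamT, hT⟩ := hE1 s hs (ε / 2) hε2
  -- S-BASE thresholds, uniformly over the finite base range (stated for every `b`, vacuous at `b = 0`)
  have hB : ∀ b : ℕ, ∃ β1 : ℝ, ∀ (hb : NeZero b) (β : ℝ), β1 ≤ β →
      |traceRatio b β (femtoSteps s β b) - hTraceRatio s| ≤ ε / 2 := by
    intro b
    by_cases hb0 : b = 0
    · exact ⟨0, fun hb => absurd hb0 hb.ne⟩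
    · haveI : NeZero b := ⟨hb0⟩
      obtain ⟨β1, h⟩ := hBASE b s hs (ε / 2) hε2
      exact ⟨β1, fun _ β hβ => h β hβ⟩
  choose β1 hβ1 using hB
  set βstar : ℝ := ∑ b ∈ Finset.range (M ^ 2), max (β1 b) 0 with hβstar
  have hβ1le : ∀ b : ℕ, b < M ^ 2 → β1 b ≤ βstar := fun b hb =>
    (le_max_left _ _).trans (Finset.single_le_sum (f := fun b => max (β1 b) 0) (fun i _ => le_max_right _ _)
      (Finset.mem_range.2 hb))
  set Mstar : ℝ := max βstar 1 with hMstar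
  have hM1 : 1 ≤ Mstar := le_max_right _ _
  have hMpos : 0 < Mstar := lt_of_lt_of_le one_pos hM1
  refine ⟨M ^ 2, min (min lamT (1 / 2)) (1 / (4 * Mstar)),
    lt_min (lt_min hlamT (by norm_num)) (by positivity), ?_⟩
  intro lam hlam hle L _ hL β hW
  have hleT : lam ≤ lamT := hle.trans ((min_le_left _ _).trans (min_le_left _ _))
  have hlehalf : lam ≤ 1 / 2 := hle.trans ((min_le_left _ _).trans (min_le_right _ _))
  have hleM : lam ≤ 1 / (4 * Mstar) := hle.trans (min_le_right _ _)
  have hle1 : lam ≤ 1 := by linarith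
  -- E1 landing and the matched coarse coupling on the base
  obtain ⟨k, b, hMb, hbM2, hbL, hLb⟩ := landing hM hL
  haveI hb : NeZero b := ⟨by omega⟩
  obtain ⟨β₁, hβ₁1, hmatch⟩ :=
    exists_matched b (v := invRunningCoupling β L) (one_le_invRunningCoupling_of_window hlam hlehalf hW)
  have hβ₁ge : β1 b ≤ β₁ :=
    ((hβ1le b hbM2).trans ((le_max_left _ _).trans
      ((le_of_lam_small hlam hle1 hMpos hleM).trans (matched_ge hlam hW hβ₁1 hmatch))))
  have hTow := hT lam hlam hleT L hL β hW b k hMb hbM2 hbL hLb β₁ hβ₁1 hmatch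
  have hBas := hβ1 b hb β₁ hβ₁ge
  calc |traceRatio L β (femtoSteps s β L) - hTraceRatio s|
      = |(traceRatio L β (femtoSteps s β L) - traceRatio b β₁ (femtoSteps s β₁ b)) +
          (traceRatio b β₁ (femtoSteps s β₁ b) - hTraceRatio s)| := by congr 1; ring
    _ ≤ |traceRatio L β (femtoSteps s β L) - traceRatio b β₁ (femtoSteps s β₁ b)| +
          |traceRatio b β₁ (femtoSteps s β₁ b) - hTraceRatio s| := abs_add_le _ _
    _ ≤ ε := by linarith

/-! ## §2 ★ Hence TOWER-E1 and S-BASE give back the all-pairs S-TOWER of rev 1 -/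

/-- ★ **Rev 2 ⇒ rev 1 modulo S-BASE**: TOWER-E1 and S-BASE imply the ALL-PAIRS two-lattice universality text of skeleton rev 1
(`Stmt.stub_twoLatticeUniversality` / rev-2 `Stmt.towerAllPairsR1`, verbatim), by §1 and `twoLatticeUniversality_of_uniform`.  With the tree's
`towerE1_of_tower` (rev 1 ⇒ rev 2, unconditionally) the two registered XL texts are interchangeable given the fixed-lattice law.
[cite: Luscher1983, §3] [cite: MontvayMunster1994, (3.145)] -/
theorem tower_of_towerE1_of_base
    (hE1 : ∀ s : ℝ, 0 < s → ∀ ε : ℝ, 0 < ε → ∃ M : ℕ, 2 ≤ M ∧ ∃ lam0 : ℝ, 0 < lam0 ∧ ∀ lam : ℝ, 0 < lam → lam ≤ lam0 →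
      ∀ (L : ℕ) [NeZero L], M ^ 2 ≤ L → ∀ β : ℝ, InFemtoWindow lam β L →
        ∀ (b k : ℕ) [NeZero b], M ≤ b → b < M ^ 2 → b * M ^ (k + 1) ≤ L → L < b * M ^ k * (M + 1) →
          ∀ β₁ : ℝ, 1 ≤ β₁ → invRunningCoupling β₁ b = invRunningCoupling β L →
            |traceRatio L β (femtoSteps s β L) - traceRatio b β₁ (femtoSteps s β₁ b)| ≤ ε)
    (hBASE : ∀ (L1 : ℕ) [NeZero L1] (s : ℝ), 0 < s → ∀ ε : ℝ, 0 < ε → ∃ β1 : ℝ, ∀ β : ℝ, β1 ≤ β →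
      |traceRatio L1 β (femtoSteps s β L1) - hTraceRatio s| ≤ ε) :
    ∀ s : ℝ, 0 < s → ∀ ε : ℝ, 0 < ε → ∃ L0 : ℕ, ∃ lam0 : ℝ, 0 < lam0 ∧ ∀ lam : ℝ, 0 < lam → lam ≤ lam0 →
      ∀ (L1 : ℕ) [NeZero L1], L0 ≤ L1 → ∀ (L : ℕ) [NeZero L], L1 ≤ L → ∀ β : ℝ, InFemtoWindow lam β L →
        ∀ β₁ : ℝ, 1 ≤ β₁ → invRunningCoupling β₁ L1 = invRunningCoupling β L →
          |traceRatio L β (femtoSteps s β L) - traceRatio L1 β₁ (femtoSteps s β₁ L1)| ≤ ε :=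
  twoLatticeUniversality_of_uniform (uniform_of_towerE1_of_base hE1 hBASE)

end Tower

end Summit.QuantumFields.YangMills.Theorems.FemtoTransferGap.TwoLattice

end
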